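import Summits.QuantumFields.YangMills.Theorems.FluctuationComparisonRegPrIntLOrganTangentSeedHClause
import Summits.QuantumFields.YangMills.Theorems.FluctuationComparisonRegPrIntLOrganTangentBidiscMixedDifference
import Mathlib.Analysis.Calculus.MeanValue
import HarnessLib

/-!
# Crux `FluctuationComparisonRegPrIntL` (stmt-QuantumFields-20520, rung R3), PATH-B v18∕v18.1 organ O1ᵘ-H, SEED LINEAGE:
# **THE SEED GRADIENT ROW** — at the seed height, the size-blind FIRST-difference letter of the frozen seed (free at a degenerate square, TN-GR (1))
# + (β)-analyticity of `log ρ_T`, `log ρ′_T` ⟹ a FIRST-DIFFERENCE ROW `|h(U·e^v@a) − h(U)| ≤ gT·(‖v‖∕θ)` with `gT = C(B, rA, r)·σ^{1−r}`,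
# seed-proportional and VOLUME-FREE — by the ONE-VARIABLE two-constants transfer at the tip of a slit (tree engine, BY NAME) + the mean value inequality

Cell `ym3-torus` (rung R3 = continuum `SU(2)` Yang–Mills on T³ — NOT d = 4, NOT infinite volume, NOT a mass gap, NOT Clay), width copy `ym3-torus-px5` (gen 19;
LEAD w3 g25 WORD №21 «SEED GRADIENT ROW → px5 g19 (MINE∕NO)», px5 «MINE» 04:23Z).  `--kind proof --supports stmt-QuantumFields-20520 --as helper`, count-neutral,
DEFINITION-FREE, default heartbeats, `autoImplicit false`; no registry ∕ binder ∕ `Lines/` edit.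

WHY (LEAD №20∕№21, px19 g19 FINDING TN-GR-12-bis).  The LIN knit's channel 3 (Resp2 tested on `F₀₀ = h_{Ts}∘Φ_V`) needs `L2Row`s of FIRST differences of
`h_{Ts}` itself — gradient rows — uniform AND seed-proportional; no such row is derivable Theorems-side from the v18.1 frame (TN-GR-12: window-path masses grow
like `θ_j^{−1∕2}`; GA's (β)-rows are uniform but not seed-small).  At the SEED they are free in print's currency: the frozen seed S2 is SIZE-BLIND, so the
degenerate square `b′ = b` gives `|h_T(U·e^v@a) − h_T(U)| ≤ ωT` for EVERY one-bond move, and (β) gives holomorphy along the move with one oscillation bound;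
the one-variable two-constants estimate (the 1-D twin of ✓TopConversion) converts the pair into a ROW.
* §1 ★`norm_sub_le_mul_of_segment_of_analytic` (segment `s₁ := rA·θ∕3` in §3 via ✓`RemainderExplicitMarkovRate.cosh_one_lt_three`) — ABSTRACT 1-D TRANSFER: `g : ℂ → ℂ` holomorphic on `ball 0 ρ`, OSCILLATION `‖g z − g 0‖ ≤ B`
  there, REAL increments `‖g s − g 0‖ ≤ σ` for `s ∈ [0, s₁]` (`0 < σ`, `0 < B`, `0 < s₁`, `s₁·cosh 1 < ρ`), any `r ∈ ]0,1]`: for `s ∈ [0, s₁∕2]`,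
  `‖g s − g 0‖ ≤ (25·(min σ B)^{1−r}·B^r ∕ ((s₁∕2)·r²))·s` — ✓`GAN24.DerivativeRateTransferAnalytic.norm_deriv_le_on_half_segment` (the segment-tip engine
  ✓`BalabanUV.Beta.RemainderExplicitMarkovRate.norm_deriv_le_of_segment` on the translates) gives the derivative along the half segment; Mathlib's
  `Convex.norm_image_sub_le_of_norm_hasDerivWithin_le` integrates it.
* §2 `firstDiff_of_seedClause` — the size-blind FIRST-difference letter from the S3-shaped (v17.2 :372) seed pair clause at the degenerate square `b′ = b`
  (`σ := ωT·e^{−κ·0} = ωT`), for the junction's convenience.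
* §3 ★★`gradientRow_of_seed_of_analytic` — THE ROW: `0 < θ`, `0 < rA`, `0 < B`, `0 < σ`, room `cH + 2·√3·rA ≤ 1`; the first-difference letter `hseed1` for
  `h := f − f′` on the θ-window; (β) INLINE (`AnalyticPairWindowAt θ rA B`'s body, as ✓pen 9 ∕ ✓p799301) for `f` AND `f′`; then for every bond `a`, move `‖v‖ ≤ rA·θ∕6`
  and `U ∈ PlaqSmall (cH·θ)`: `|h (update U a (U a·expPt v)) − h U| ≤ (150·(min σ (2B))^{1−r}·(2B)^r ∕ (rA·r²))·(‖v‖∕θ)`; `…_half` = the instance `r = 1∕2`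
  (`gT = 600·√(min σ (2B)·2B)∕rA`, the «α = 1∕2» of LEAD №21).
NOT HERE: the v18.2 TEXT item (the seed's gradient INPUT `gT` in O1ᵘ-H's input block ∕ S3ᴴ's seed block — ideator g28 ∕ desk), the junction instantiating
`σ := ωT`, `θ := 49∕50·θBal_T` (v18.1) and the class profile `B := Bρ T`; the LIN knit's use.

HONEST FRAMING: [folklore] complex analysis over the tree's two-constants engine (credit beta-d4-p3 ∕ b2b-balaban-gan24-p3 lineages) + window bookkeeping (credit
pen 9 w3 g24, whose lemmas are reused BY NAME); the seed letter and (β) are HYPOTHESES — that the runs' densities satisfy them is print's claim ([Balaban1985UV3]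
p.263 (c)), not formalised; nothing of Bałaban's analysis is asserted or proved; LINᵘ-H′∕JVARᵘ-H′∕O1ᵘ-H v2.1∕S1aᴴ∕S2β, crux 20520, `YM3TorusSU2` NOT proved; registry
`Lines/semiclassical_s2beta.lean` v11.4 (★★OWNER RULING №36) and `Lines/runpair_organ.lean` untouched, nothing here is registered; rung R3 = SU(2) YM₃ on T³ — NOT
d = 4, NOT infinite volume, NOT a mass gap, NOT Clay; the Yang–Mills mass gap is NOT proved by any of this.
-/

set_option autoImplicit false

noncomputable section

namespace Summit.QuantumFields.YangMills.Theorems.FluctuationComparisonRegPrIntLOrganTangentSeedGradientRow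

open Metric Set Function
open Literature.MathematicalPhysics.QuantumFieldTheory.Balaban1983to89
open T4CubeChartExp (expPt)
open Summit.QuantumFields.BalabanUV.Beta.GAN24.DerivativeRateTransferAnalytic (rho_pos norm_deriv_le_on_half_segment)
open Summit.QuantumFields.YangMills.Theorems.OrganTangentSeedHClause (plaqSmall_move smul_normalize_eq norm_normalize_le)
open Summit.QuantumFields.YangMills.Theorems.OrganTangentBidiscMixedDifference (differentiableOn_slice_fst)
open Summit.QuantumFields.BalabanUV.Beta.RemainderExplicitMarkovRate (cosh_one_lt_three)

/-! ## §1 The abstract one-variable transfer -/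

/-- ★ **THE ONE-VARIABLE TWO-CONSTANTS TRANSFER, INCREMENT FORM**: `g` holomorphic on `ball 0 ρ` with OSCILLATION `‖g z − g 0‖ ≤ B` there and REAL increments
`‖g s − g 0‖ ≤ σ` on `[0, s₁]` (`0 < σ`, `0 < B`, `0 < s₁`, `s₁·cosh 1 < ρ`): for every `r ∈ ]0,1]` and every real `s ∈ [0, s₁∕2]`,
`‖g s − g 0‖ ≤ (25·(min σ B)^{1−r}·B^r∕((s₁∕2)·r²))·s`. [folklore] -/
theorem norm_sub_le_mul_of_segment_of_analytic {g : ℂ → ℂ} {ρ s₁ σ B : ℝ}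
    (hg : DifferentiableOn ℂ g (ball (0 : ℂ) ρ)) (hB : ∀ z ∈ ball (0 : ℂ) ρ, ‖g z - g 0‖ ≤ B)
    (hσ : ∀ s : ℝ, 0 ≤ s → s ≤ s₁ → ‖g (s : ℂ) - g 0‖ ≤ σ) (hσ0 : 0 < σ) (hB0 : 0 < B) (hs₁ : 0 < s₁) (hs₁ρ : s₁ * Real.cosh 1 < ρ)
    {r : ℝ} (hr : 0 < r) (hr1 : r ≤ 1) {s : ℝ} (hs0 : 0 ≤ s) (hs : s ≤ s₁ / 2) :
    ‖g (s : ℂ) - g 0‖ ≤ (25 * ((min σ B) ^ (1 - r) * B ^ r) / (s₁ / 2 * r ^ 2)) * s := by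
  have hρ : 0 < ρ := rho_pos hs₁ hs₁ρ
  -- the increment function `G z := g z − g 0`
  have hG : DifferentiableOn ℂ (fun z => g z - g 0) (ball (0 : ℂ) ρ) := hg.sub (differentiableOn_const _)
  have hGB : ∀ z ∈ ball (0 : ℂ) ρ, ‖g z - g 0‖ ≤ B := hB
  have hGε : ∀ t : ℝ, 0 ≤ t → t ≤ s₁ → ‖g (t : ℂ) - g 0‖ ≤ min σ B := by
    intro t ht0 ht1
    refine le_min (hσ t ht0 ht1) (hB _ ?_)
    rw [mem_ball_zero_iff, Complex.norm_real, Real.norm_eq_abs, abs_of_nonneg ht0]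
    have : s₁ ≤ s₁ * Real.cosh 1 := le_mul_of_one_le_right hs₁.le (Real.one_le_cosh 1)
    linarith
  have hmin0 : 0 < min σ B := lt_min hσ0 hB0
  have hminB : min σ B ≤ B := min_le_right _ _
  set D : ℝ := 25 * ((min σ B) ^ (1 - r) * B ^ r) / (s₁ / 2 * r ^ 2) with hD
  -- derivative bound along the half segment (the engine on the translates)
  have hder : ∀ t : ℝ, 0 ≤ t → t ≤ s₁ / 2 → ‖deriv (fun z => g z - g 0) (t : ℂ)‖ ≤ D := fun t ht0 ht =>
    norm_deriv_le_on_half_segment hG hGB hGε hs₁ hs₁ρ hmin0 hminB hr hr1 ht0 ht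
  -- the real-parameter function and its derivative
  have hseg : ∀ t ∈ Icc (0 : ℝ) (s₁ / 2), HasDerivWithinAt (fun t : ℝ => g (t : ℂ) - g 0)
      (deriv (fun z => g z - g 0) (t : ℂ)) (Icc (0 : ℝ) (s₁ / 2)) t := by
    intro t ht
    have htball : (t : ℂ) ∈ ball (0 : ℂ) ρ := by
      rw [mem_ball_zero_iff, Complex.norm_real, Real.norm_eq_abs, abs_of_nonneg ht.1]
      have : s₁ ≤ s₁ * Real.cosh 1 := le_mul_of_one_le_right hs₁.le (Real.one_le_cosh 1)
      linarith [ht.2]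
    have hdiff : DifferentiableAt ℂ (fun z => g z - g 0) (t : ℂ) := hG.differentiableAt (isOpen_ball.mem_nhds htball)
    have h1 : HasDerivAt (fun t : ℝ => (fun z => g z - g 0) (t : ℂ)) (deriv (fun z => g z - g 0) (t : ℂ)) t :=
      hdiff.hasDerivAt.comp_ofReal
    exact h1.hasDerivWithinAt
  have hbound : ∀ t ∈ Icc (0 : ℝ) (s₁ / 2), ‖deriv (fun z => g z - g 0) (t : ℂ)‖ ≤ D := fun t ht => hder t ht.1 ht.2
  have key := (convex_Icc (0 : ℝ) (s₁ / 2)).norm_image_sub_le_of_norm_hasDerivWithin_le hseg hbound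
    (left_mem_Icc.mpr (by linarith)) ⟨hs0, hs⟩
  simp only [Complex.ofReal_zero, sub_self, sub_zero, Real.norm_eq_abs, abs_of_nonneg hs0] at key
  exact key

/-! ## §2 The size-blind first-difference letter from the seed pair clause -/

/-- **FIRST DIFFERENCES ARE FREE AT THE SEED** (TN-GR (1)): the S3-shaped (v17.2 :372) size-blind seed pair clause at the degenerate square `b′ := b`,
`(U, V, W, Z) := (U, V, U, U)`, gives `|h V − h U| ≤ ωT` for every one-bond modification inside the window. [folklore] -/
theorem firstDiff_of_seedClause {P : Params} {j : ℕ} {θ ωT κ : ℝ}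
    {h : GaugeField P j ↥(Matrix.specialUnitaryGroup (Fin 2) ℂ) → ℝ}
    (hseed : ∀ (b b' : PBond P j) (U V W Z : GaugeField P j ↥(Matrix.specialUnitaryGroup (Fin 2) ℂ)),
      PlaqSmall θ U → PlaqSmall θ V → PlaqSmall θ W → PlaqSmall θ Z →
      (∀ e, e ≠ b → U e = V e) → (∀ e, e ≠ b' → U e = W e) → (∀ e, e ≠ b' → V e = Z e) → (∀ e, e ≠ b → W e = Z e) →
      |(h U - h V) - (h W - h Z)| ≤ ωT * Real.exp (-(κ * (b.src.tdist b'.src : ℝ))))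
    (a : PBond P j) (U V : GaugeField P j ↥(Matrix.specialUnitaryGroup (Fin 2) ℂ)) (hU : PlaqSmall θ U) (hV : PlaqSmall θ V)
    (hVU : ∀ e, e ≠ a → V e = U e) : |h V - h U| ≤ ωT := by
  have key := hseed a a U V U U hU hV hU hU (fun e he => (hVU e he).symm) (fun _ _ => rfl) (fun e he => hVU e he) (fun _ _ => rfl)
  have h0 : a.src.tdist a.src = 0 := by unfold Site.tdist; simp
  rw [h0, Nat.cast_zero, mul_zero, neg_zero, Real.exp_zero, mul_one, sub_self, sub_zero] at key
  rwa [abs_sub_comm] at key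

/-! ## §3 The seed gradient row -/

/-- ★★ **THE SEED GRADIENT ROW** (see the module docstring): from the size-blind first-difference letter `hseed1` for `h := f − f′` on the θ-window and the (β)
clauses for `f`, `f′` (INLINE, `AnalyticPairWindowAt θ rA B` body), with room `cH + 2·√3·rA ≤ 1`: for every bond `a`, move `‖v‖ ≤ rA·θ∕6`, `U ∈ PlaqSmall (cH·θ)` and
`r ∈ ]0,1]`, `|h (U·e^v@a) − h U| ≤ (150·(min σ (2B))^{1−r}·(2B)^r∕(rA·r²))·(‖v‖∕θ)` (segment `[0, rA·θ∕3]`, `cosh 1 < 3`). [cite: Balaban1985UV3, p.263] -/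
theorem gradientRow_of_seed_of_analytic {P : Params} {j : ℕ} [DecidableEq (PBond P j)] {θ rA B σ cH : ℝ}
    (hθ : 0 < θ) (hrA : 0 < rA) (hB0 : 0 < B) (hσ0 : 0 < σ) (hroom : cH + 2 * Real.sqrt 3 * rA ≤ 1)
    {f f' : GaugeField P j ↥(Matrix.specialUnitaryGroup (Fin 2) ℂ) → ℝ}
    (hseed1 : ∀ (a : PBond P j) (U V : GaugeField P j ↥(Matrix.specialUnitaryGroup (Fin 2) ℂ)),
      PlaqSmall θ U → PlaqSmall θ V → (∀ e, e ≠ a → V e = U e) → |(f V - f' V) - (f U - f' U)| ≤ σ)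
    (hβ : ∀ U : GaugeField P j ↥(Matrix.specialUnitaryGroup (Fin 2) ℂ), PlaqSmall θ U →
      ∀ (b b' : PBond P j) (w w' : Fin 3 → ℝ), ‖w‖ ≤ 1 → ‖w'‖ ≤ 1 →
        ∃ g : ℂ × ℂ → ℂ, DifferentiableOn ℂ g (ball (0 : ℂ) (rA * θ) ×ˢ ball (0 : ℂ) (rA * θ)) ∧
          (∀ (s t : ℝ) (V Z : GaugeField P j ↥(Matrix.specialUnitaryGroup (Fin 2) ℂ)), |s| < rA * θ → |t| < rA * θ →
            (∀ e, e ≠ b → V e = U e) → V b = U b * expPt (s • w) → (∀ e, e ≠ b' → Z e = V e) → Z b' = V b' * expPt (t • w') →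
            g ((s : ℂ), (t : ℂ)) = ((f Z : ℝ) : ℂ)) ∧
          ∀ z ∈ ball (0 : ℂ) (rA * θ) ×ˢ ball (0 : ℂ) (rA * θ), ‖g z - g 0‖ ≤ B)
    (hβ' : ∀ U : GaugeField P j ↥(Matrix.specialUnitaryGroup (Fin 2) ℂ), PlaqSmall θ U →
      ∀ (b b' : PBond P j) (w w' : Fin 3 → ℝ), ‖w‖ ≤ 1 → ‖w'‖ ≤ 1 →
        ∃ g : ℂ × ℂ → ℂ, DifferentiableOn ℂ g (ball (0 : ℂ) (rA * θ) ×ˢ ball (0 : ℂ) (rA * θ)) ∧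
          (∀ (s t : ℝ) (V Z : GaugeField P j ↥(Matrix.specialUnitaryGroup (Fin 2) ℂ)), |s| < rA * θ → |t| < rA * θ →
            (∀ e, e ≠ b → V e = U e) → V b = U b * expPt (s • w) → (∀ e, e ≠ b' → Z e = V e) → Z b' = V b' * expPt (t • w') →
            g ((s : ℂ), (t : ℂ)) = ((f' Z : ℝ) : ℂ)) ∧
          ∀ z ∈ ball (0 : ℂ) (rA * θ) ×ˢ ball (0 : ℂ) (rA * θ), ‖g z - g 0‖ ≤ B)
    (a : PBond P j) (v : Fin 3 → ℝ) (U : GaugeField P j ↥(Matrix.specialUnitaryGroup (Fin 2) ℂ))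
    (hv : ‖v‖ ≤ rA * θ / 6) (hU : PlaqSmall (cH * θ) U) {r : ℝ} (hr : 0 < r) (hr1 : r ≤ 1) :
    |(f (update U a (U a * expPt v)) - f' (update U a (U a * expPt v))) - (f U - f' U)|
      ≤ (150 * ((min σ (2 * B)) ^ (1 - r) * (2 * B) ^ r) / (rA * r ^ 2)) * (‖v‖ / θ) := by
  -- degenerate move
  by_cases hv0 : v = 0
  · subst hv0
    have hUU : update U a (U a * expPt 0) = U := by
      funext e; by_cases he : e = a
      · subst he; rw [update_self, T4CubeChartExp.expPt_zero, mul_one]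
      · rw [update_of_ne he]
    rw [hUU, sub_self, abs_zero, norm_zero, zero_div, mul_zero]
  -- unit direction and size
  set w : Fin 3 → ℝ := ‖v‖⁻¹ • v with hw
  have hwn : ‖w‖ ≤ 1 := norm_normalize_le hv0
  have hsw : ‖v‖ • w = v := smul_normalize_eq hv0
  have hs0 : 0 ≤ ‖v‖ := norm_nonneg v
  -- windows: `U` is θ-small; every move of size `≤ rA·θ∕3` keeps it θ-small
  have hcH : cH ≤ 1 := by nlinarith [Real.sqrt_nonneg 3, hrA.le, Real.sq_sqrt (show (0:ℝ) ≤ 3 by norm_num)]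
  have hUθ : PlaqSmall θ U := fun p => (hU p).trans_le (by nlinarith [hθ.le])
  have hmoveθ : ∀ t : ℝ, 0 ≤ t → t ≤ rA * θ / 3 → PlaqSmall θ (update U a (U a * expPt (t • w))) := by
    intro t ht0 ht
    have h1 := plaqSmall_move hU a t hwn
    refine fun p => (h1 p).trans_le ?_
    rw [abs_of_nonneg ht0]
    have h3 : Real.sqrt 3 * t ≤ Real.sqrt 3 * (rA * θ / 3) := mul_le_mul_of_nonneg_left ht (Real.sqrt_nonneg 3)
    nlinarith [hθ.le, Real.sqrt_nonneg 3]
  -- the (β) data for `f` and `f′` along the move at `a` in direction `w` (second slot idle: `b′ := a`, `w′ := w`)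
  obtain ⟨g₁, hg₁, hg₁i, hg₁B⟩ := hβ U hUθ a a w w hwn hwn
  obtain ⟨g₂, hg₂, hg₂i, hg₂B⟩ := hβ' U hUθ a a w w hwn hwn
  have hρ : 0 < rA * θ := mul_pos hrA hθ
  -- the one-variable slice `G z := g₁ (z,0) − g₂ (z,0)`
  have hG : DifferentiableOn ℂ (fun z => g₁ (z, 0) - g₂ (z, 0)) (ball (0 : ℂ) (rA * θ)) :=
    (differentiableOn_slice_fst hg₁ (mem_ball_self hρ)).sub (differentiableOn_slice_fst hg₂ (mem_ball_self hρ))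
  have h00 : ((0 : ℂ), (0 : ℂ)) = (0 : ℂ × ℂ) := rfl
  have hGB : ∀ z ∈ ball (0 : ℂ) (rA * θ), ‖g₁ (z, 0) - g₂ (z, 0) - (g₁ (0, 0) - g₂ (0, 0))‖ ≤ 2 * B := by
    intro z hz
    have hz2 : (z, (0 : ℂ)) ∈ ball (0 : ℂ) (rA * θ) ×ˢ ball (0 : ℂ) (rA * θ) := ⟨hz, mem_ball_self hρ⟩
    have e : g₁ (z, 0) - g₂ (z, 0) - (g₁ (0, 0) - g₂ (0, 0)) = (g₁ (z, 0) - g₁ 0) - (g₂ (z, 0) - g₂ 0) := by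
      rw [h00]; ring
    rw [e]
    have h1 : ‖g₁ (z, 0) - g₁ 0‖ ≤ B := hg₁B _ hz2
    have h2 : ‖g₂ (z, 0) - g₂ 0‖ ≤ B := hg₂B _ hz2
    calc ‖(g₁ (z, 0) - g₁ 0) - (g₂ (z, 0) - g₂ 0)‖ ≤ ‖g₁ (z, 0) - g₁ 0‖ + ‖g₂ (z, 0) - g₂ 0‖ := norm_sub_le _ _
      _ ≤ 2 * B := by linarith
  -- on the real segment the slice IS the discrepancy along the move
  have hval : ∀ t : ℝ, 0 ≤ t → t ≤ rA * θ / 3 →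
      g₁ ((t : ℂ), 0) - g₂ ((t : ℂ), 0) = (((f (update U a (U a * expPt (t • w))) - f' (update U a (U a * expPt (t • w))) : ℝ) : ℂ)) := by
    intro t ht0 ht
    have htabs : |t| < rA * θ := by rw [abs_of_nonneg ht0]; linarith
    have h0abs : |(0 : ℝ)| < rA * θ := by rw [abs_zero]; exact hρ
    have e1 := hg₁i t 0 (update U a (U a * expPt (t • w))) (update U a (U a * expPt (t • w))) htabs h0abs
      (fun e he => update_of_ne he _ _) (update_self _ _ _) (fun _ _ => rfl) (by rw [zero_smul, T4CubeChartExp.expPt_zero, mul_one])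
    have e2 := hg₂i t 0 (update U a (U a * expPt (t • w))) (update U a (U a * expPt (t • w))) htabs h0abs
      (fun e he => update_of_ne he _ _) (update_self _ _ _) (fun _ _ => rfl) (by rw [zero_smul, T4CubeChartExp.expPt_zero, mul_one])
    simp only [Complex.ofReal_zero] at e1 e2
    rw [e1, e2]; push_cast; ring
  have hval0 : g₁ (0, 0) - g₂ (0, 0) = (((f U - f' U) : ℝ) : ℂ) := by
    have h := hval 0 le_rfl (by positivity)
    have hUU : update U a (U a * expPt ((0 : ℝ) • w)) = U := by
      funext e; by_cases he : e = a
      · subst he; rw [update_self, zero_smul, T4CubeChartExp.expPt_zero, mul_one]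
      · rw [update_of_ne he]
    rw [hUU, Complex.ofReal_zero] at h
    exact h
  -- real increments `≤ σ` on `[0, rA·θ∕3]` by the size-blind letter
  have hGσ : ∀ t : ℝ, 0 ≤ t → t ≤ rA * θ / 3 →
      ‖g₁ ((t : ℂ), 0) - g₂ ((t : ℂ), 0) - (g₁ (0, 0) - g₂ (0, 0))‖ ≤ σ := by
    intro t ht0 ht
    rw [hval t ht0 ht, hval0, ← Complex.ofReal_sub, Complex.norm_real, Real.norm_eq_abs]
    exact hseed1 a U _ hUθ (hmoveθ t ht0 ht) (fun e he => update_of_ne he _ _)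
  -- the transfer on `[0, rA·θ∕3]` (`(rA·θ∕3)·cosh 1 < rA·θ` by `cosh 1 < 3`)
  have hs₁ : 0 < rA * θ / 3 := by positivity
  have hs₁ρ : rA * θ / 3 * Real.cosh 1 < rA * θ := by nlinarith [cosh_one_lt_three, hρ]
  have key := norm_sub_le_mul_of_segment_of_analytic (g := fun z => g₁ (z, 0) - g₂ (z, 0)) hG hGB hGσ hσ0 (by linarith) hs₁ hs₁ρ hr hr1 hs0
    (by linarith)
  rw [hval ‖v‖ hs0 (by linarith), hval0, ← Complex.ofReal_sub, Complex.norm_real, Real.norm_eq_abs, hsw] at key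
  refine key.trans (le_of_eq ?_)
  field_simp
  ring

/-- ★★ **THE SEED GRADIENT ROW AT THE STANDARD SPLIT `r = 1∕2`**: `|h (U·e^v@a) − h U| ≤ (600·((min σ (2B))^{1∕2}·(2B)^{1∕2})∕rA)·(‖v‖∕θ)` — `gT ≍ √(σ·B)∕rA`,
seed-proportional and volume-free (LEAD №21's «α = 1∕2»). [cite: Balaban1985UV3, p.263] -/
theorem gradientRow_of_seed_of_analytic_half {P : Params} {j : ℕ} [DecidableEq (PBond P j)] {θ rA B σ cH : ℝ}
    (hθ : 0 < θ) (hrA : 0 < rA) (hB0 : 0 < B) (hσ0 : 0 < σ) (hroom : cH + 2 * Real.sqrt 3 * rA ≤ 1)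
    {f f' : GaugeField P j ↥(Matrix.specialUnitaryGroup (Fin 2) ℂ) → ℝ}
    (hseed1 : ∀ (a : PBond P j) (U V : GaugeField P j ↥(Matrix.specialUnitaryGroup (Fin 2) ℂ)),
      PlaqSmall θ U → PlaqSmall θ V → (∀ e, e ≠ a → V e = U e) → |(f V - f' V) - (f U - f' U)| ≤ σ)
    (hβ : ∀ U : GaugeField P j ↥(Matrix.specialUnitaryGroup (Fin 2) ℂ), PlaqSmall θ U →
      ∀ (b b' : PBond P j) (w w' : Fin 3 → ℝ), ‖w‖ ≤ 1 → ‖w'‖ ≤ 1 →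
        ∃ g : ℂ × ℂ → ℂ, DifferentiableOn ℂ g (ball (0 : ℂ) (rA * θ) ×ˢ ball (0 : ℂ) (rA * θ)) ∧
          (∀ (s t : ℝ) (V Z : GaugeField P j ↥(Matrix.specialUnitaryGroup (Fin 2) ℂ)), |s| < rA * θ → |t| < rA * θ →
            (∀ e, e ≠ b → V e = U e) → V b = U b * expPt (s • w) → (∀ e, e ≠ b' → Z e = V e) → Z b' = V b' * expPt (t • w') →
            g ((s : ℂ), (t : ℂ)) = ((f Z : ℝ) : ℂ)) ∧
          ∀ z ∈ ball (0 : ℂ) (rA * θ) ×ˢ ball (0 : ℂ) (rA * θ), ‖g z - g 0‖ ≤ B)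
    (hβ' : ∀ U : GaugeField P j ↥(Matrix.specialUnitaryGroup (Fin 2) ℂ), PlaqSmall θ U →
      ∀ (b b' : PBond P j) (w w' : Fin 3 → ℝ), ‖w‖ ≤ 1 → ‖w'‖ ≤ 1 →
        ∃ g : ℂ × ℂ → ℂ, DifferentiableOn ℂ g (ball (0 : ℂ) (rA * θ) ×ˢ ball (0 : ℂ) (rA * θ)) ∧
          (∀ (s t : ℝ) (V Z : GaugeField P j ↥(Matrix.specialUnitaryGroup (Fin 2) ℂ)), |s| < rA * θ → |t| < rA * θ →
            (∀ e, e ≠ b → V e = U e) → V b = U b * expPt (s • w) → (∀ e, e ≠ b' → Z e = V e) → Z b' = V b' * expPt (t • w') →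
            g ((s : ℂ), (t : ℂ)) = ((f' Z : ℝ) : ℂ)) ∧
          ∀ z ∈ ball (0 : ℂ) (rA * θ) ×ˢ ball (0 : ℂ) (rA * θ), ‖g z - g 0‖ ≤ B)
    (a : PBond P j) (v : Fin 3 → ℝ) (U : GaugeField P j ↥(Matrix.specialUnitaryGroup (Fin 2) ℂ))
    (hv : ‖v‖ ≤ rA * θ / 6) (hU : PlaqSmall (cH * θ) U) :
    |(f (update U a (U a * expPt v)) - f' (update U a (U a * expPt v))) - (f U - f' U)|
      ≤ (600 * ((min σ (2 * B)) ^ (1 / 2 : ℝ) * (2 * B) ^ (1 / 2 : ℝ)) / rA) * (‖v‖ / θ) := by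
  have key := gradientRow_of_seed_of_analytic hθ hrA hB0 hσ0 hroom hseed1 hβ hβ' a v U hv hU (r := 1 / 2) (by norm_num) (by norm_num)
  refine key.trans (le_of_eq ?_)
  have e : (1 : ℝ) - 1 / 2 = 1 / 2 := by norm_num
  rw [e]
  field_simp
  ring

end Summit.QuantumFields.YangMills.Theorems.FluctuationComparisonRegPrIntLOrganTangentSeedGradientRow

end
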